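import Summits.ResolutionOfSingularities.ResolutionOfSingularities.Theorems.WeightedInvariantWeightedThesisHypersurfaceRatedRule
import Summits.ResolutionOfSingularities.ResolutionOfSingularities.Theorems.WeightedInvariantWeightedThesisHypersurfaceStrategyAssembly
import Summits.ResolutionOfSingularities.ResolutionOfSingularities.Theorems.WeightedInvariantWeightedThesisHypersurfaceTowerStep
import HarnessLib

/-!
# A hypersurface RATED rule is a hypersurface centre STRATEGY (door (γ) proved)

Topic: `Summits/ResolutionOfSingularities/ResolutionOfSingularities/Theorems`. Route
`ResolutionOfSingularities/WeightedInvariant`, crux `Theses.WeightedInvariant.WeightedThesis`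
(stmt-ResolutionOfSingularities-0569), line `datum-glued-split`, lead c8, RESHAPE 8.

A `HypersurfaceRatedRule p` (`Theorems/…HypersurfaceRatedRule.lean`) carries an invariant into a value
set that is only LINEARLY ordered, with finitely many values per pair, the chartwise drop `(iv)`, and
well-orderedness of the values met along the towers of ONE pair. This file proves that this is enough
to run the route's tower, by producing a `HypersurfaceCentreStrategy p` (`Theorems/…HypersurfaceStrategy.lean`):

* `HypersurfaceRatedRule.exists_isMax_inv` — `max_Y inv` is attained (finitely many values);
* `InvDrop.inv_drop_of_ratedRule` — the invariant of the successor pair on the GLOBAL cobordant blow-up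
  is everywhere strictly below `max_Y inv`: every point of `B₊` lies in a chart `B₊(U) ⟶ B₊` (an open
  immersion pulling the strict transform back to the chartwise one), so functoriality `(i)` of `inv`
  and the chartwise drop `(iv)` conclude — the proof of `inv_drop_of_hypersurfaceDatum` verbatim with
  the guard "not regular" (Włodarczyk 2022, Thm. 4.3.1);
* `HypersurfaceRatedRule.inv_lt_of_step`, `acc_step`, `wellFounded_step` — hence one tower step
  strictly lowers `max inv`, and since the values met along the towers of a pair are well-ordered,
  every pair is accessible for the tower-step relation: `(T)` holds;
* `HypersurfaceRatedRule.nonempty_strategy`, registered form `hyp_nonempty_strategy_of_ratedRule` —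
  **every hypersurface rated rule is a hypersurface centre strategy**;
* `weightedThesis_of_ratedRule_of_forall_berghRydh_charP` — rated rules at every prime and prime-wise
  Bergh–Rydh give `WeightedThesis` (through `weightedThesis_of_hypersurfaceStrategy_of_forall_berghRydh_charP`).

So the line offers the planner THREE typed restatement targets for stmt-0571, in decreasing strength,
each with its consumer side landed: hypersurface datum (RESHAPE 7) ⇒ rated rule ⇒ strategy (RESHAPE 8).
-/

noncomputable section

open scoped LaurentPolynomial
open LaurentPolynomial CategoryTheory CategoryTheory.Limits AlgebraicGeometry TopologicalSpace
open Literature.AlgebraicGeometry.Resolution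
open Summit.ResolutionOfSingularities.ResolutionOfSingularities.Theses.WeightedInvariant
open Summit.ResolutionOfSingularities.ResolutionOfSingularities.Theorems

set_option linter.dupNamespace false -- mandated namespace of this single-conjunct summit

/-! ## The maximum of the invariant -/

namespace Summit.ResolutionOfSingularities.ResolutionOfSingularities.Theorems.HypersurfaceRatedRule

variable {p : ℕ} (R : HypersurfaceRatedRule p) {k : Type} [Field k] [CharP k p] [PerfectField k]

/-- On a non-empty `Y` the invariant of a rated rule attains its maximum on a hypersurface pair (it
takes finitely many values, `(fin)`). [folklore] -/
theorem exists_isMax_inv {Y : Scheme.{0}} (f : Y ⟶ Spec (.of k)) [Smooth f] [IsSeparated f]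
    [QuasiCompact f] [Nonempty Y] (X : Y.IdealSheafData) (hX : IsLocallyPrincipal X)
    (hXi : IsIntegral X.subscheme) : ∃ y : Y, ∀ y' : Y, R.inv f X y' ≤ R.inv f X y :=
  hyp_exists_isMax_of_finite_range (R.inv f X) (R.finite_range_inv f X hX hXi)

end Summit.ResolutionOfSingularities.ResolutionOfSingularities.Theorems.HypersurfaceRatedRule

/-! ## The invariant drops on the global cobordant blow-up -/

namespace Summit.ResolutionOfSingularities.ResolutionOfSingularities.Theorems.DatumToEmbedded.InvDrop

-- `R'.plus.ι ⁻¹ᵁ _` / chart immersions inside `rw` motives on the glued scheme (as in the source file):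
set_option backward.isDefEq.respectTransparency false in
/-- **The invariant of a rated rule drops on the GLOBAL cobordant blow-up** (the statement of
`inv_drop_of_hypersurfaceDatum` for `R : HypersurfaceRatedRule p`, guard "not regular"): for a singular
hypersurface pair `(Y, I)` with `inv` maximal at `y₀`, a Rees filtration `R'` with the pieces of the
centre `R.centre f I` whose cobordant blow-up `B₊ = R'.plus → Y → Spec k` is smooth separated
quasi-compact, and granted that the successor pair `(B₊, σˢ(I)|_{B₊})` is again a hypersurface pair, at
every point `y'` of `B₊` the invariant of the successor pair is strictly below `inv y₀`: `y' = φ_U(b)`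
for the chart `φ_U : B₊(U) ⟶ B₊` over some affine `U`, an open immersion pulling `σˢ(I)|_{B₊}` back to
the chartwise strict transform, so `(i)` for `inv` and the chartwise drop `(iv)` conclude.
[cite: Wlodarczyk2022, Thm. 4.3.1] -/
theorem inv_drop_of_ratedRule
    {p : ℕ} (R : HypersurfaceRatedRule p) {k : Type} [Field k] [CharP k p] [PerfectField k]
    {Y : Scheme.{0}} (f : Y ⟶ Spec (.of k)) [Smooth f] [IsSeparated f] [QuasiCompact f]
    (I : Y.IdealSheafData) (hI : IsLocallyPrincipal I) (hIi : IsIntegral I.subscheme)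
    (hsing : ¬ Scheme.IsRegular I.subscheme) (y₀ : Y) (hmax : ∀ y : Y, R.inv f I y ≤ R.inv f I y₀)
    (R' : ReesFiltration Y) (hR' : R'.ideal = (R.centre f I).piece)
    [Smooth (R'.πPlus ≫ f)] [IsSeparated (R'.πPlus ≫ f)] [QuasiCompact (R'.πPlus ≫ f)]
    (hI' : IsLocallyPrincipal (R'.strictTransformPlus I))
    (hI'i : IsIntegral (R'.strictTransformPlus I).subscheme) (y' : (R'.plus : Scheme.{0})) :
    R.inv (R'.πPlus ≫ f) (R'.strictTransformPlus I) y' < R.inv f I y₀ := by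
  have hJ : ∀ U : Y.affineOpens, (R'.filtration U).ideal = (R.centre f I).chartIdeals U :=
    fun U => funext fun n => by rw [ReesFiltration.filtration_ideal, hR']; rfl
  -- `B` and `B₊` are locally Noetherian (the centre is a regular weighted centre under the guard)
  haveI : IsLocallyNoetherian Y := LocallyOfFiniteType.isLocallyNoetherian f
  haveI : LocallyOfFiniteType R'.π := WeightedThesis.GlobalCobordantPlus.locallyOfFiniteType_π
    (R.centre f I) R' hR' (R.isRegularWeightedCentre_centre f I hI hIi hsing)
  haveI : IsLocallyNoetherian R'.cobordantBlowup := LocallyOfFiniteType.isLocallyNoetherian R'.π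
  haveI : IsLocallyNoetherian (R'.plus : Scheme.{0}) :=
    LocallyOfFiniteType.isLocallyNoetherian (R'.πPlus ≫ f)
  -- `y' = φ b` for the chart `φ = φ_U` over some affine `U`
  obtain ⟨U, hU⟩ := exists_mem_image_plusChart R' y'
  obtain ⟨θ, hθ⟩ := exists_ringEquiv (R'.filtration U) ((R.centre f I).chartIdeals U) (hJ U)
  obtain ⟨φ, hφ⟩ := exists_fac R' U _ θ hθ (hJ U)
  haveI := isOpenImmersion_of_fac R' U _ θ φ hφ
  obtain ⟨b, rfl⟩ := exists_apply_eq_of_fac R' U _ θ hθ φ hφ (hJ U) y' hU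
  -- the chart is a smooth `Y`-morphism from a smooth separated quasi-compact `k`-scheme
  have hφf : φ ≫ R'.πPlus ≫ f = (R.centre f I).cobordantPlusι U ≫ f := by
    rw [← Category.assoc, comp_πPlus_of_fac R' U _ θ hθ φ hφ]
    rfl
  haveI : Smooth ((R.centre f I).cobordantPlusι U ≫ f) := by rw [← hφf]; infer_instance
  haveI : IsSeparated ((R.centre f I).cobordantPlusι U ≫ f) := by rw [← hφf]; infer_instance
  haveI : QuasiCompact ((R.centre f I).cobordantPlusι U ≫ f) := by rw [← hφf]; infer_instance
  -- locality of `inv` along the chart (the successor pair is a hypersurface pair), then `(iv)`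
  have key := R.inv_comap (R'.πPlus ≫ f) ((R.centre f I).cobordantPlusι U ≫ f) φ hφf
    (R'.strictTransformPlus I) hI' hI'i b
  rw [comap_strictTransformPlus_of_fac R' U _ θ hθ φ hφ] at key
  exact key.symm.trans_lt (R.inv_cobordantPlus_lt f I hI hIi hsing U b y₀ hmax)

end Summit.ResolutionOfSingularities.ResolutionOfSingularities.Theorems.DatumToEmbedded.InvDrop

/-! ## The reachable part of the tower-step relation is well-founded -/

namespace Summit.ResolutionOfSingularities.ResolutionOfSingularities.Theorems.HypersurfaceRatedRule

variable {p : ℕ} (R : HypersurfaceRatedRule p) {k : Type} [Field k] [CharP k p] [PerfectField k]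

/-- **One step of the tower lowers `max inv`**: for any choice of maximum points, the maximum of the
invariant of the successor pair is strictly below that of the pair (`inv_drop_of_ratedRule`).
[cite: Wlodarczyk2022, Thm. 4.3.1] -/
theorem inv_lt_of_step {P' P : HypersurfacePair k}
    (h : HypersurfacePair.Step (fun ⦃Y : Scheme.{0}⦄ (f : Y ⟶ Spec (.of k)) X => R.centre f X) P' P)
    (y' : P'.Y) (y₀ : P.Y) (hy₀ : ∀ y : P.Y, R.inv P.f P.X y ≤ R.inv P.f P.X y₀) :
    R.inv P'.f P'.X y' < R.inv P.f P.X y₀ := by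
  obtain ⟨hsing, R', hR', hs, hsep, hqc, hlp, hint, rfl⟩ := h
  haveI := hs; haveI := hsep; haveI := hqc
  exact DatumToEmbedded.InvDrop.inv_drop_of_ratedRule R P.f P.X P.isLocallyPrincipal P.isIntegral
    hsing y₀ hy₀ R' hR' hlp hint y'

/-- **Every hypersurface pair is accessible for the tower-step relation of a rated rule**: along the
pairs reachable from `P₀` the measure `max inv` strictly decreases at every step
(`inv_lt_of_step`) and takes values in the well-ordered set `(wf)` of values met along the towers of
`P₀`; well-founded induction over that set. [folklore] -/
theorem acc_step (P₀ : HypersurfacePair k) :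
    Acc (HypersurfacePair.Step fun ⦃Y : Scheme.{0}⦄ (f : Y ⟶ Spec (.of k)) X => R.centre f X) P₀ := by
  -- the centre rule, the measure `max_Y inv`, the reachable pairs and the values met along them
  let c : ∀ ⦃Y : Scheme.{0}⦄, (Y ⟶ Spec (.of k)) → Y.IdealSheafData → ReesAlgebraData Y :=
    fun ⦃Y : Scheme.{0}⦄ (f : Y ⟶ Spec (.of k)) X => R.centre f X
  let μ : HypersurfacePair k → R.Γ := fun P => R.inv P.f P.X (Classical.choose
    (R.exists_isMax_inv P.f P.X P.isLocallyPrincipal P.isIntegral))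
  have hμ : ∀ (P : HypersurfacePair k) (y : P.Y), R.inv P.f P.X y ≤ μ P := fun P y =>
    Classical.choose_spec (R.exists_isMax_inv P.f P.X P.isLocallyPrincipal P.isIntegral) y
  have hμlt : ∀ {P' P : HypersurfacePair k}, HypersurfacePair.Step c P' P → μ P' < μ P :=
    fun {P' P} h => R.inv_lt_of_step h _ _ (hμ P)
  let Reach : HypersurfacePair k → Prop :=
    Relation.ReflTransGen (fun P P' : HypersurfacePair k => HypersurfacePair.Step c P' P) P₀
  let T : Set R.Γ := {γ | ∃ P : HypersurfacePair k, Reach P ∧ γ ∈ Set.range (R.inv P.f P.X)}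
  have hT : T.IsWF := R.isWF_values P₀
  have hmem : ∀ P, Reach P → μ P ∈ T := fun P hP => ⟨P, hP, _, rfl⟩
  -- induction on `max inv ∈ T`
  suffices key : ∀ γ ∈ T, ∀ P : HypersurfacePair k, Reach P → μ P = γ →
      Acc (HypersurfacePair.Step c) P from
    key _ (hmem P₀ Relation.ReflTransGen.refl) P₀ Relation.ReflTransGen.refl rfl
  intro γ hγ
  refine Set.WellFoundedOn.induction hT hγ (P := fun γ => ∀ P : HypersurfacePair k, Reach P →
    μ P = γ → Acc (HypersurfacePair.Step c) P) ?_
  intro γ _ ih P hP hPγ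
  refine Acc.intro P fun P' hstep => ?_
  have hP' : Reach P' := Relation.ReflTransGen.tail hP hstep
  exact ih (μ P') (hmem P' hP') (hPγ ▸ hμlt hstep) P' hP' rfl

/-- **The cobordant tower of a rated rule stops**: its tower-step relation is well-founded over every
perfect field of characteristic `p`. [folklore] -/
theorem wellFounded_step :
    WellFounded (HypersurfacePair.Step (k := k) fun ⦃Y : Scheme.{0}⦄ (f : Y ⟶ Spec (.of k)) X =>
      R.centre f X) :=
  ⟨fun P => R.acc_step P⟩

/-- **Every hypersurface rated rule is a hypersurface centre strategy**: the centre and its three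
properties are kept, termination is `wellFounded_step`. [folklore] -/
theorem nonempty_strategy (R : HypersurfaceRatedRule p) : Nonempty (HypersurfaceCentreStrategy p) :=
  ⟨{ centre := R.centre
     isRegularWeightedCentre_centre := fun _ _ _ _ _ f _ _ _ X hX hXi hsing =>
       R.isRegularWeightedCentre_centre f X hX hXi hsing
     genericPoint_not_mem_support_centre := fun _ _ _ _ _ _ f _ _ _ i _ _ hX hsing =>
       R.genericPoint_not_mem_support_centre f i hX hsing
     centre_comap := fun _ _ _ _ _ _ f _ _ _ f₁ _ _ _ g _ _ hg X hX hXi hsing n =>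
       R.centre_comap f f₁ g hg X hX hXi hsing n
     wellFounded_step := fun _ _ _ _ => R.wellFounded_step }⟩

end Summit.ResolutionOfSingularities.ResolutionOfSingularities.Theorems.HypersurfaceRatedRule

namespace Summit.ResolutionOfSingularities.ResolutionOfSingularities.Theorems

/-- **Registered form `hyp_nonempty_strategy_of_ratedRule`** (registered stub of line `datum-glued-split`,
RESHAPE 8): a hypersurface rated rule in characteristic `p` yields a hypersurface centre strategy in
characteristic `p`. [folklore] -/
theorem hyp_nonempty_strategy_of_ratedRule : ∀ {p : ℕ}, Summit.ResolutionOfSingularities.ResolutionOfSingularities.Theorems.HypersurfaceRatedRule p → Nonempty (Summit.ResolutionOfSingularities.ResolutionOfSingularities.Theorems.HypersurfaceCentreStrategy p) :=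
  fun R => R.nonempty_strategy

/-- **`WeightedThesis` from hypersurface RATED rules and the characteristic-`p` instances of
Bergh–Rydh**: if for every prime `p` a hypersurface rated rule exists and prime-wise Bergh–Rydh holds,
every reduced separated scheme of finite type over every perfect field of positive characteristic has a
resolution (rated rule ⇒ strategy ⇒ `weightedThesis_of_hypersurfaceStrategy_of_forall_berghRydh_charP`).
[cite: Wlodarczyk2022, Thm 1.1.6; BerghRydh2019, Thm 5; AbramovichTemkinWlodarczyk2024, §1.9] -/
theorem weightedThesis_of_ratedRule_of_forall_berghRydh_charP : (∀ p : ℕ, p.Prime → Nonempty (Summit.ResolutionOfSingularities.ResolutionOfSingularities.Theorems.HypersurfaceRatedRule p)) → (∀ p : ℕ, p.Prime → ∀ (k : Type) [Field k] [CharP k p] [PerfectField k] (V : AlgebraicGeometry.Scheme.{0}) (g : V ⟶ AlgebraicGeometry.Spec (.of k)) [AlgebraicGeometry.IsIntegral V] [AlgebraicGeometry.IsSeparated g] [AlgebraicGeometry.LocallyOfFiniteType g] [AlgebraicGeometry.QuasiCompact g], (∀ v : V, ∃ (A : Type) (_ : AddCommGroup A) (_ : Finite A) (_ : DecidableEq A)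 (S : Type) (_ : CommRing S) (_ : Algebra k S) (𝒮 : A → Submodule k S) (_ : GradedAlgebra 𝒮), Algebra.FiniteType k S ∧ Algebra.Smooth k S ∧ ∃ φ : AlgebraicGeometry.Spec (.of (𝒮 0)) ⟶ V, AlgebraicGeometry.Etale φ ∧ v ∈ Set.range φ ∧ φ ≫ g = AlgebraicGeometry.Spec.map (CommRingCat.ofHom (algebraMap k (𝒮 0)))) → Literature.AlgebraicGeometry.Resolution.Scheme.HasResolution V) → Summit.ResolutionOfSingularities.ResolutionOfSingularities.Theses.WeightedInvariant.WeightedThesis :=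
  fun hR hBR => weightedThesis_of_hypersurfaceStrategy_of_forall_berghRydh_charP
    (fun p hp => (Classical.choice (hR p hp)).nonempty_strategy) hBR

end Summit.ResolutionOfSingularities.ResolutionOfSingularities.Theorems

end
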